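import Summits.CriticalPhenomena.Ising3D.Control2DMixture
import Summits.CriticalPhenomena.Ising3D.Control2DRecordIsing
import Summits.CriticalPhenomena.Ising3D.Control2DNonVacuity
import Mathlib.Tactic.Linarith
import Mathlib.Tactic.NormNum
import HarnessLib

/-!
# Which clauses of `A2D′` the 2D record needs: a kernel ledger at the control column `Δ_σ = 1/8`
(cell `pub-ising3x`, seat controls-1 gen 40; PAPER §6.7 / Appendix E — CONTROL-ONLY)

HONEST FRAMING: lottery ticket; floor = tightest certified 3D Ising CFT bounds; no exact-solution
claim without a proof. CONTROL-ONLY (`d = 2`, `Δ_σ = 1/8` an INPUT, axiom set `A2D′ = (G, δ) = (2, 1)`: sub-gap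
scalars at one location `x`, the others at `Δ ≥ G = 2`; spin 2 in `{2} ∪ [2 + δ, ∞) = {2} ∪ [3, ∞)`; unitarity);
nothing here is about `d = 3`; no certificate, functional or number of the record is touched.

WHAT THIS FILE ADDS — each item a short corollary of an explicit witness already in the tree (the free-boson
vertex datum `vertexData2D (1/8)`, the generalised free field `gffData2D (1/8)`, the Ising datum `isingData2D`,
the Ising–free-boson mixtures `isingBosonMix t` of `Control2DMixture`) or of the `Λ = 19` record
(`allowedLocations_eighth`):

* (δ, the spin-2 gap) `ExcludedAt.mono_delta`, `TwoSided.mono_delta` (a larger spin-2 gap is a smaller class);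
  with `2 + δ ≤ 5/2` the location `x = 1/2` is NOT excludable (`not_excludedAt_half_of_le`), every
  `TwoSided (1/8) 2 δ w ε_lo U` with `w ≤ 1/2` has `ε_lo < 1/2 < U` (`twoSided_needs_spinTwoGap`) and every box
  certificate misses `1/2` (`boxExcluded_misses_half`) — whereas at `δ = 1` the record EXCLUDES `x = 1/2` and
  `x = 1/4` (`excludedAt_half_record`); so the spin-2 gap of `A2D′` is load-bearing, with threshold
  `δ⋆ = inf {δ | ExcludedAt (1/8) 2 δ (1/2)} ∈ [1/2, 1]` and both rays (`spinTwoGapThreshold_half`); with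
  `δ ≤ 1/4` even the stress-tensor-free generalised free field (`x = 1/4`, spin 2 from `9/4`) is admissible
  (`not_excludedAt_quarter_of_le`) — the clause `{2} ∪ [2+δ, ∞)` does not by itself demand a stress tensor.
* (G, the continuum threshold) with `G ≤ 1 = Δ_ε` every `TwoSided (1/8) G δ w ε_lo U` and every
  `BoxExcluded (1/8) G δ e₁ e₂` with `δ ≤ 1` is FALSE: the Ising datum (scalars `{1} ∪ [4,∞)`) then has no
  sub-`G` scalar and sits in every such class (`twoSided_false_of_G_le_one`, `boxExcluded_false_of_G_le_one`).
* (B, the `ε`-box behind the `c` datum) with a WIDE box `[e₁, e₂] ∋ 1/2, 1` and `δ ≤ 1/2`,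
  `CTwoSided (1/8) 2 δ e₁ e₂ c_lo c_hi` forces `c_lo < c < c_hi` for EVERY `c ∈ [1/2, 1]` (`cTwoSided_wideBox`, all
  mixtures qualify): the two-sidedness of the `c` datum of record (`78125/156258 < c < 125/248` on the box
  `[49/50, 20001/20000]` at `δ = 1`, `Control2DRecord.record_centralCharge_fractions`) is inherited from the
  certified `ε`-box (which the `t < 1` mixtures miss by their scalar at `1/2`) and from the spin-2 gap — not from
  the stress-tensor hypothesis alone.
* `a2d_clause_ledger_eighth` — the items in one conjunction (Appendix E).

NOT claimed: anything at `δ ∈ (1/2, 1)` or `G ∈ (1, 2]` beyond the record; `A = {1}`; anything three-dimensional.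

References: R. Rattazzi, V. S. Rychkov, E. Tonni, A. Vichi, JHEP 12 (2008) 031, §5 [cite: RattazziEtAl2008, §5];
I. Heemskerk, J. Penedones, J. Polchinski, J. Sully, JHEP 10 (2009) 079, §2
[cite: HeemskerkPenedonesPolchinskiSully2009, §2]; A. A. Belavin, A. M. Polyakov, A. B. Zamolodchikov,
Nucl. Phys. B 241 (1984) 333 [cite: BelavinPolyakovZamolodchikov1984, §3]. Tree: `ExcludedAt`, `TwoSided`,
`BoxExcluded` (`Control2DIsland`), `CTwoSided` (`Control2DOpeTwoSided`), `vertexData2D` (`Control2DVertexData`),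
`gffData2D` (`Control2DNonVacuity`), `isingData2D` (`Control2DIsingSpectrum`), `isingBosonMix`,
`wardCentralCharge_realised` (`Control2DMixture`), `allowedLocations_eighth` (`Control2DRecordIsing`).
-/

namespace Summit.CriticalPhenomena.Ising3D.Control2D

open Set
open Literature.MathematicalPhysics.QuantumFieldTheory.ConformalBootstrap3D

/-! ### The clause ledger at `Δ_σ = 1/8`: (δ) the spin-2 gap -/

/-- Enlarging the spin-2 gap shrinks the class: `ExcludedAt` is monotone in `δ`. [folklore] -/
theorem ExcludedAt.mono_delta {s G δ δ' x : ℝ} (h : ExcludedAt s G δ x) (hδ : δ ≤ δ') : ExcludedAt s G δ' x := by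
  intro D hU hC hS hT
  refine h D hU hC hS fun i hi => ?_
  rcases hT i hi with h1 | h1
  · exact Or.inl h1
  · exact Or.inr (le_trans (by linarith) (mem_Ici.mp h1))

/-- `TwoSided` is monotone in `δ`. [folklore] -/
theorem TwoSided.mono_delta {s G δ δ' w εlo U : ℝ} (h : TwoSided s G δ w εlo U) (hδ : δ ≤ δ') :
    TwoSided s G δ' w εlo U := by
  intro D hU hC hT x hwx hS
  refine h D hU hC (fun i hi => ?_) x hwx hS
  rcases hT i hi with h1 | h1
  · exact Or.inl h1
  · exact Or.inr (le_trans (by linarith) (mem_Ici.mp h1))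

/-- A class-1 statement excludes every location of its window below its lower edge. [folklore] -/
theorem TwoSided.excludedAt {s G δ w εlo U x : ℝ} (h : TwoSided s G δ w εlo U) (hwx : w ≤ x) (hx : x ≤ εlo) :
    ExcludedAt s G δ x :=
  fun D hU hC hS hT => absurd (h D hU hC hT x hwx hS).1 (not_lt.mpr hx)

/-- **(δ ≤ 1/2) The location `x = 1/2` is not excludable with spin-2 gap `2 + δ ≤ 5/2`**: the free-boson vertex
datum at `Δ_σ = 1/8` has scalars in `{1/2} ∪ [2,∞)` and spin 2 in `{2} ∪ [5/2,∞)`. Contrast: at the record's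
`δ = 1` the location `1/2` IS excluded (`excludedAt_half_record`, `Λ = 19`). [folklore] -/
theorem not_excludedAt_half_of_le {δ : ℝ} (hδ : δ ≤ 1 / 2) : ¬ ExcludedAt (1 / 8) 2 δ (1 / 2) := by
  intro h
  have hs : (0 : ℝ) < 1 / 8 := by norm_num
  refine h (vertexData2D (1 / 8)) (vertexData2D_isUnitary hs) (vertexData2D_satisfiesCrossing hs) ?_ ?_
  · have := vertexData2D_scalarsIn hs
    rwa [show (4 : ℝ) * (1 / 8) = 1 / 2 by norm_num] at this
  · intro i hi
    rcases vertexData2D_spinTwoIn (1 / 8) i hi with h1 | h1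
    · exact Or.inl h1
    · right
      have h2 : (2 : ℝ) + min 2 (4 * (1 / 8)) ≤ (vertexData2D (1 / 8)).Δ i := h1
      rw [show (2 : ℝ) + min 2 (4 * (1 / 8)) = 5 / 2 by norm_num] at h2
      exact le_trans (by linarith) h2

/-- **(δ ≤ 1/2) Every class-1 statement whose window reaches `1/2` has its lower edge below `1/2`** and its
upper edge above: `TwoSided (1/8) 2 δ w ε_lo U`, `δ ≤ 1/2`, `w ≤ 1/2` ⇒ `ε_lo < 1/2 < U`. With `δ = 1` the record
certifies `ε_lo = 99/100` for every window — the spin-2 gap of `A2D′` is load-bearing. [folklore] -/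
theorem twoSided_needs_spinTwoGap {δ w εlo U : ℝ} (hδ : δ ≤ 1 / 2) (h : TwoSided (1 / 8) 2 δ w εlo U)
    (hw : w ≤ 1 / 2) : εlo < 1 / 2 ∧ 1 / 2 < U := by
  constructor
  · by_contra hle
    exact not_excludedAt_half_of_le hδ (h.excludedAt hw (not_lt.mp hle))
  · by_contra hle
    have hex : ExcludedAt (1 / 8) 2 δ (1 / 2) := fun D hU hC hS hT =>
      absurd (h D hU hC hT (1 / 2) hw hS).2 hle
    exact not_excludedAt_half_of_le hδ hex

/-- **(δ ≤ 1/2) Every box certificate misses `1/2`**: `BoxExcluded (1/8) 2 δ e₁ e₂`, `δ ≤ 1/2` ⇒ `1/2 ∉ [e₁, e₂]`.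
[folklore] -/
theorem boxExcluded_misses_half {δ e₁ e₂ : ℝ} (hδ : δ ≤ 1 / 2) (h : BoxExcluded (1 / 8) 2 δ e₁ e₂) :
    (1 / 2 : ℝ) ∉ Icc e₁ e₂ :=
  fun hmem => not_excludedAt_half_of_le hδ (h.excludedAt hmem)

/-- **(δ = 1) The record excludes `x = 1/2`** (and `x = 1/4`): the allowed-location set at the column is inside
`(99/100, 20001/20000)` (`allowedLocations_eighth`, the `Λ = 19` class-1 rung). [cite: RattazziEtAl2008, §5] -/
theorem excludedAt_half_record : ExcludedAt (1 / 8) 2 1 (1 / 2) ∧ ExcludedAt (1 / 8) 2 1 (1 / 4) := by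
  constructor
  · by_contra h
    have := allowedLocations_eighth.2 h
    norm_num at this
  · by_contra h
    have := allowedLocations_eighth.2 h
    norm_num at this

/-- **The spin-2-gap threshold at the location `1/2`** as one real number: with
`δ⋆ = inf {δ | ExcludedAt (1/8) 2 δ (1/2)}` (non-empty by the record, bounded below by `1/2` by the boson),
`1/2 ≤ δ⋆ ≤ 1`; by monotonicity every `δ > δ⋆` excludes `1/2` and no `δ ≤ 1/2` does. Where `δ⋆` lies in
`[1/2, 1]` is NOT claimed. [folklore] -/
theorem spinTwoGapThreshold_half :
    sInf {δ : ℝ | ExcludedAt (1 / 8) 2 δ (1 / 2)} ∈ Icc (1 / 2 : ℝ) 1 ∧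
      (∀ δ : ℝ, sInf {δ : ℝ | ExcludedAt (1 / 8) 2 δ (1 / 2)} < δ → ExcludedAt (1 / 8) 2 δ (1 / 2)) ∧
        (∀ δ : ℝ, δ ≤ 1 / 2 → ¬ ExcludedAt (1 / 8) 2 δ (1 / 2)) := by
  have hne : ({δ : ℝ | ExcludedAt (1 / 8) 2 δ (1 / 2)}).Nonempty := ⟨1, excludedAt_half_record.1⟩
  have hbdd : BddBelow {δ : ℝ | ExcludedAt (1 / 8) 2 δ (1 / 2)} := by
    refine ⟨1 / 2, fun δ hδ => ?_⟩
    by_contra hlt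
    exact not_excludedAt_half_of_le (not_le.mp hlt).le hδ
  refine ⟨⟨?_, csInf_le hbdd excludedAt_half_record.1⟩, fun δ hδ => ?_, fun δ hδ => not_excludedAt_half_of_le hδ⟩
  · refine le_csInf hne fun δ hδ => ?_
    by_contra hlt
    exact not_excludedAt_half_of_le (not_le.mp hlt).le hδ
  · obtain ⟨δ', hδ', hlt⟩ := (csInf_lt_iff hbdd hne).mp hδ
    exact ExcludedAt.mono_delta hδ' hlt.le

/-- A spin-2 quasi-primary of the generalised free field has `Δ ≥ 2s + 2` (labels `(n, m)` with `|n - m| = 2`).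
[folklore] -/
theorem gffData2D_spinTwo_ge (s : ℝ) (i : (gffData2D s).ι) (hi : (gffData2D s).spin i = 2) :
    2 * s + 2 ≤ (gffData2D s).Δ i := by
  obtain ⟨⟨n, m⟩, _⟩ := i
  have hi' : max n m - min n m = 2 := hi
  show 2 * s + 2 ≤ 2 * s + n + m
  have h2 : (2 : ℝ) ≤ (n : ℝ) + m := by
    have : 2 ≤ n + m := by
      rcases le_total n m with h | h
      · rw [max_eq_right h, min_eq_left h] at hi'; omega
      · rw [max_eq_left h, min_eq_right h] at hi'; omega
    exact_mod_cast this
  linarith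

/-- **(δ ≤ 1/4) Even without a stress tensor**: with spin-2 gap `2 + δ ≤ 9/4` the generalised free field of
dimension `1/8` (scalars `{1/4} ∪ {9/4, 17/4, …}`, spin 2 from `9/4`, NO quasi-primary at `(2,2)`) is admissible, so the
location `x = 1/4` is not excludable — the clause `{2} ∪ [2+δ, ∞)` does not by itself demand a stress tensor.
[cite: HeemskerkPenedonesPolchinskiSully2009, §2] -/
theorem not_excludedAt_quarter_of_le {δ : ℝ} (hδ : δ ≤ 1 / 4) : ¬ ExcludedAt (1 / 8) 2 δ (1 / 4) := by
  intro h
  have hs : (0 : ℝ) < 1 / 8 := by norm_num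
  refine h (gffData2D (1 / 8)) (gffData2D_isUnitary hs) (gffData2D_satisfiesCrossing hs) ?_ ?_
  · intro i hi
    obtain ⟨n, hn⟩ := gffData2D_scalarsIn (1 / 8) i hi
    rcases Nat.eq_zero_or_pos n with h0 | hpos
    · left
      rw [mem_singleton_iff, ← hn, h0]
      norm_num
    · right
      rw [mem_Ici, ← hn]
      have : (1 : ℝ) ≤ n := by exact_mod_cast hpos
      linarith
  · intro i hi
    right
    rw [mem_Ici]
    have := gffData2D_spinTwo_ge (1 / 8) i hi
    linarith

/-! ### The clause ledger at `Δ_σ = 1/8`: (G) the continuum threshold -/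

/-- **(G ≤ 1) No class-1 statement survives a continuum threshold at or below `Δ_ε = 1`**: the Ising datum has all
its scalars in `{1} ∪ [4, ∞) ⊆ [G, ∞)`, hence satisfies `ScalarsIn ({x} ∪ [G,∞))` for EVERY `x`, and its spin-2
content `{2} ∪ [3,∞)` fits `δ ≤ 1`; taking `x = max w U` contradicts `x < U`. Contrast: at the record's `G = 2`,
`δ = 1` the statement holds for every window with edges `99/100`, `20001/20000` (`twoSided_2d_kernel099`).
[folklore] -/
theorem twoSided_false_of_G_le_one {G δ : ℝ} (hG : G ≤ 1) (hδ : δ ≤ 1) (w εlo U : ℝ) :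
    ¬ TwoSided (1 / 8) G δ w εlo U := by
  have hSx : ∀ x : ℝ, isingData2D.ScalarsIn ({x} ∪ Ici G) := by
    intro x i hi
    rcases isingData2D_scalarsIn i hi with h1 | h1
    · right; rw [mem_singleton_iff] at h1; rw [mem_Ici, h1]; exact hG
    · right; exact le_trans (by linarith) (mem_Ici.mp h1)
  have hT : isingData2D.SpinTwoIn ({2} ∪ Ici (2 + δ)) := by
    intro i hi
    rcases isingData2D_spinTwoIn i hi with h1 | h1
    · exact Or.inl h1
    · exact Or.inr (le_trans (by linarith) (mem_Ici.mp h1))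
  intro h
  have := h isingData2D isingData2D_isUnitary isingData2D_satisfiesCrossing hT (max w U) (le_max_left _ _) (hSx _)
  linarith [le_max_right w U, this.2]

/-- **(G ≤ 1) No box certificate at all**: `¬ BoxExcluded (1/8) G δ e₁ e₂` for `G ≤ 1`, `δ ≤ 1` (the Ising datum is in
every such class). Contrast: at `G = 2`, `δ = 1` the record's box and gap certificates together exclude every
location outside `(99/100, 20001/20000)` (`allowedLocations_eighth`). [folklore] -/
theorem boxExcluded_false_of_G_le_one {G δ : ℝ} (hG : G ≤ 1) (hδ : δ ≤ 1) (e₁ e₂ : ℝ) :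
    ¬ BoxExcluded (1 / 8) G δ e₁ e₂ := by
  have hS : isingData2D.ScalarsIn (Icc e₁ e₂ ∪ Ici G) := by
    intro i hi
    rcases isingData2D_scalarsIn i hi with h1 | h1
    · right; rw [mem_singleton_iff] at h1; rw [mem_Ici, h1]; exact hG
    · right; exact le_trans (by linarith) (mem_Ici.mp h1)
  have hT : isingData2D.SpinTwoIn ({2} ∪ Ici (2 + δ)) := by
    intro i hi
    rcases isingData2D_spinTwoIn i hi with h1 | h1
    · exact Or.inl h1
    · exact Or.inr (le_trans (by linarith) (mem_Ici.mp h1))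
  exact fun h => h isingData2D isingData2D_isUnitary isingData2D_satisfiesCrossing hS hT

/-! ### The clause ledger at `Δ_σ = 1/8`: (B) the `ε`-box behind the `c` datum -/

/-- **(wide box, δ ≤ 1/2) `c` is not determined**: if the `ε`-box contains both `1/2` and `1` and the spin-2 gap is
`2 + δ ≤ 5/2`, then every member of the Ising–free-boson family is in the class of `CTwoSided (1/8) 2 δ e₁ e₂ c_lo c_hi`,
so `c_lo < c < c_hi` for EVERY `c ∈ [1/2, 1]` — in particular `c_lo < 1/2` and `1 < c_hi`. The record's
`78125/156258 < c < 125/248` is certified on the box `[49/50, 20001/20000]` at `δ = 1`; the `t < 1` mixtures miss that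
box by their scalar at `1/2`. [cite: BelavinPolyakovZamolodchikov1984, §3] -/
theorem cTwoSided_wideBox {δ e₁ e₂ clo chi : ℝ} (hδ : δ ≤ 1 / 2) (he₁ : e₁ ≤ 1 / 2) (he₂ : 1 ≤ e₂)
    (h : CTwoSided (1 / 8) 2 δ e₁ e₂ clo chi) {c : ℝ} (hc : c ∈ Icc (1 / 2 : ℝ) 1) : clo < c ∧ c < chi := by
  obtain ⟨D, hU, hC, -, hS, hT, -, hW⟩ := wardCentralCharge_realised hc
  have hS' : D.ScalarsIn (Icc e₁ e₂ ∪ Ici 2) := by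
    intro i hi
    rcases hS i hi with h1 | h1
    · left
      rcases h1 with h1 | h1
      · rw [h1]; exact ⟨he₁, le_trans (by norm_num) he₂⟩
      · rw [mem_singleton_iff] at h1; rw [h1]; exact ⟨le_trans he₁ (by norm_num), he₂⟩
    · exact Or.inr h1
  have hT' : D.SpinTwoIn ({2} ∪ Ici (2 + δ)) := by
    intro i hi
    rcases hT i hi with h1 | h1
    · exact Or.inl h1
    · exact Or.inr (le_trans (by linarith) (mem_Ici.mp h1))
  exact h D hU hC hS' hT' c (by linarith [hc.1]) hW

/-- **Summary of the ledger at the control column** (one conjunction for Appendix E): (δ) `x = 1/2` excluded at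
`δ = 1`, not excludable at any `δ ≤ 1/2`, `x = 1/4` not excludable at any `δ ≤ 1/4`; (G) no `TwoSided (1/8) G δ`
statement with `G ≤ 1`, `δ ≤ 1`; (c) every Ward `c ∈ [1/2, 1]` realised with gap `1/2` and spin-2 gap `5/2`.
CONTROL-ONLY; nothing at `δ ∈ (1/2, 1)` or `G ∈ (1, 2]` other than the record is claimed. [folklore] -/
theorem a2d_clause_ledger_eighth :
    ExcludedAt (1 / 8) 2 1 (1 / 2) ∧ (∀ δ : ℝ, δ ≤ 1 / 2 → ¬ ExcludedAt (1 / 8) 2 δ (1 / 2)) ∧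
      (∀ δ : ℝ, δ ≤ 1 / 4 → ¬ ExcludedAt (1 / 8) 2 δ (1 / 4)) ∧
        (∀ G δ w εlo U : ℝ, G ≤ 1 → δ ≤ 1 → ¬ TwoSided (1 / 8) G δ w εlo U) ∧
          (∀ c ∈ Icc (1 / 2 : ℝ) 1, ∃ D : CrossingData, D.IsUnitary ∧ D.SatisfiesCrossing (1 / 8) ∧
            D.HasScalarGap (1 / 2) ∧ D.SpinTwoIn ({2} ∪ Ici (5 / 2)) ∧
              D.stressCoeff = (1 / 8 : ℝ) ^ 2 / (2 * c)) :=
  ⟨excludedAt_half_record.1, fun _ hδ => not_excludedAt_half_of_le hδ,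
    fun _ hδ => not_excludedAt_quarter_of_le hδ,
    fun _ _ w εlo U hG hδ => twoSided_false_of_G_le_one hG hδ w εlo U,
    fun _ hc => by
      obtain ⟨D, h1, h2, h3, -, h5, -, h7⟩ := wardCentralCharge_realised hc
      exact ⟨D, h1, h2, h3, h5, h7⟩⟩

end Summit.CriticalPhenomena.Ising3D.Control2D
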